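import Mathlib
import HarnessLib
import Summits.ResolutionOfSingularities.ResolutionOfSingularities.Theorems.HomologicalConductorNoZenoStableAnnihilatorReduction

/-!
# Crux `Persistence` (stmt-ResolutionOfSingularities-16484), chain W4.4b — LEMMA D, CONVERSE HALF:
# the CASIMIR maps `Σ_j z^j Θ z^{r−j}` factor through a free module, and `z^r` STABLY ANNIHILATES
# every split lattice over `A[z]/(z^{r+1})` (R4's KEPT half in EVERY characteristic)

Route `ResolutionOfSingularities/HomologicalConductor`.  OURS (cell res-hironaka, crux chain W4.4b,
`L/w44b/U12-SPEC.md` v2 §6 + res-L1-w44b-tri-1's `REFEREE-LemmaD.md` bd44bb57c06d5e7a and kernel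
helper `kept/KeptIdempotent.lean` 6f6ae019e1770cdf, whose two ring/idempotent lemmas are INLINED below
with credit — a refuter seat lands no positive files; seat res-D-pv-058, object «U14» file 2/2);
nothing here is a statement of the manuscript under review (Hironaka 2017); AI-written, weaker than
expert review.  Companion of `…PersistenceLatticeDivisibility.lean` (LEMMA D: stable annihilators of
a lattice are Casimir maps, hence divisible).

SETTING.  `A` a commutative ring, `R` a commutative `A`-algebra with a power basis `pb` whose generator
`z := pb.gen` satisfies `z ^ pb.dim = 0` (`R ≅ A[z]/(z^{r+1})`, `r + 1 = dim`), `M` an `R`-module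
(`IsScalarTower A R M`).

* `map_smul_of_commute_gen` — an `A`-linear map between `R`-modules commuting with `z` is `R`-linear.
* **`stablyAnnihilates_of_smul_eq_casimir`** (CONVERSE OF LEMMA D): if `M` is finitely generated
  projective over `A` and `c ∈ R` acts on `M` as the CASIMIR map
  `τ(Θ) : v ↦ Σ_{j<dim} z^j • Θ (z^{dim−1−j} • v)` of some `A`-linear `Θ`, then `c` STABLY ANNIHILATES
  `M`: `τ(Θ) = π ∘ ι` through the finitely generated projective `R`-module `R ⊗_A M`, with
  `ι(v) = Σ_j z^j ⊗ Θ(z^{dim−1−j} v)` (`R`-linear because `z^dim = 0` — Higman's criterion for the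
  symmetric `A`-order `R`) and `π(x ⊗ m) = x • m`.
* `sum_pow_mul_mul_pow_eq_pow`, `exists_theta_of_isCompl` (tri-1): `Θ N = 0 ∧ N^r Θ = N^r ⇒
  Σ_j N^j Θ N^{r−j} = N^r`, and such an idempotent `Θ` exists whenever `ker N^r` has a complement.
* **`stablyAnnihilates_gen_pow_of_isCompl`** (R4 KEPT, every characteristic): if `M` is f.g.
  projective over `A` and `ker (z^{dim−1} •)` has an `A`-complement, then `z^{dim−1}` stably annihilates
  `M` — no `∂/∂z`, no `(r+1)`, so the primes `p ∣ r + 1` (where the Jacobian route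
  `PersistenceJacobianKept.pderiv_mem_…` says nothing) are covered; `…_of_field` is the case `A` a
  field (every `K[z]/(z^{r+1})`-module that is finite-dimensional over `K`).

All `[folklore]`/OURS elementary module theory (Higman's criterion for Frobenius/symmetric orders).
-/

noncomputable section

-- single-problem summit: the doubled namespace component `ResolutionOfSingularities` is forced
set_option linter.dupNamespace false

open CategoryTheory TensorProduct
open Summit.ResolutionOfSingularities.ResolutionOfSingularities.Theorems.NoZeno.SandwichCluster
open scoped TensorProduct

universe u v

namespace Summit.ResolutionOfSingularities.ResolutionOfSingularities.Theorems.HomologicalConductor.PersistenceLatticeCasimir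

variable {A : Type v} [CommRing A] {R : Type u} [CommRing R] [Algebra A R]

/-! ## `A`-linear maps commuting with the generator are `R`-linear -/

/-- An `A`-linear map between `R`-modules which commutes with the power-basis generator `z` commutes
with every power of `z`. [folklore] -/
theorem map_gen_pow_smul (pb : PowerBasis A R) {M P : Type*} [AddCommGroup M] [Module R M]
    [Module A M] [IsScalarTower A R M] [AddCommGroup P] [Module R P] [Module A P]
    [IsScalarTower A R P] (f : M →ₗ[A] P) (hf : ∀ v, f (pb.gen • v) = pb.gen • f v) (n : ℕ)
    (v : M) : f ((pb.gen ^ n) • v) = (pb.gen ^ n) • f v := by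
  induction n generalizing v with
  | zero => simp
  | succ n ih => rw [pow_succ', mul_smul, hf, ih, ← mul_smul]

/-- An `A`-linear map between `R`-modules which commutes with the power-basis generator `z` is
`R`-linear (`R` is spanned over `A` by the powers of `z`). [folklore] -/
theorem map_smul_of_commute_gen (pb : PowerBasis A R) {M P : Type*} [AddCommGroup M] [Module R M]
    [Module A M] [IsScalarTower A R M] [AddCommGroup P] [Module R P] [Module A P]
    [IsScalarTower A R P] (f : M →ₗ[A] P) (hf : ∀ v, f (pb.gen • v) = pb.gen • f v) (x : R)
    (v : M) : f (x • v) = x • f v := by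
  conv_lhs => rw [← pb.basis.sum_repr x]
  conv_rhs => rw [← pb.basis.sum_repr x]
  rw [Finset.sum_smul, Finset.sum_smul, map_sum]
  refine Finset.sum_congr rfl fun i _ => ?_
  rw [pb.basis_eq_pow, smul_assoc, map_smul, map_gen_pow_smul pb f hf, smul_assoc]

/-! ## The converse of LEMMA D: Casimir maps factor through `R ⊗_A M` -/

section Casimir

variable (pb : PowerBasis A R) {M : Type u} [AddCommGroup M] [Module R M] [Module A M]
  [IsScalarTower A R M]

omit [IsScalarTower A R M] in
/-- The Casimir sum `Σ_{j<dim} z^j ⊗ Θ(z^{dim−1−j} • v)` commutes with `z` when `z^dim = 0`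
(both sides equal `Σ_{1 ≤ j < dim} z^j ⊗ Θ(z^{dim−j} • v)`). [folklore; Higman's criterion] -/
theorem casimir_commute (hnil : pb.gen ^ pb.dim = 0) (hd : 0 < pb.dim) (Θ : M →ₗ[A] M) (v : M) :
    (∑ j ∈ Finset.range pb.dim,
        (pb.gen ^ j) ⊗ₜ[A] Θ ((pb.gen ^ (pb.dim - 1 - j)) • (pb.gen • v))) =
      pb.gen • ∑ j ∈ Finset.range pb.dim, (pb.gen ^ j) ⊗ₜ[A] Θ ((pb.gen ^ (pb.dim - 1 - j)) • v) := by
  obtain ⟨d, hdd⟩ : ∃ d, pb.dim = d + 1 := ⟨pb.dim - 1, by omega⟩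
  rw [hdd, Finset.sum_range_succ', Finset.smul_sum, Finset.sum_range_succ]
  -- the two boundary terms vanish
  have h0 : (pb.gen ^ 0 : R) ⊗ₜ[A] Θ ((pb.gen ^ (d + 1 - 1 - 0)) • (pb.gen • v)) = 0 := by
    rw [← mul_smul, ← pow_succ, show d + 1 - 1 - 0 + 1 = pb.dim by omega, hnil, zero_smul,
      map_zero, TensorProduct.tmul_zero]
  have htop : pb.gen • ((pb.gen ^ d : R) ⊗ₜ[A] Θ ((pb.gen ^ (d + 1 - 1 - d)) • v)) = 0 := by
    rw [TensorProduct.smul_tmul', smul_eq_mul, ← pow_succ', show d + 1 = pb.dim by omega, hnil,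
      TensorProduct.zero_tmul]
  rw [h0, add_zero, htop, add_zero]
  refine Finset.sum_congr rfl fun j hj => ?_
  have hj' : j < d := Finset.mem_range.mp hj
  rw [TensorProduct.smul_tmul', smul_eq_mul, ← pow_succ', ← mul_smul, ← pow_succ,
    show d + 1 - 1 - (j + 1) + 1 = d + 1 - 1 - j by omega]

/-- **CONVERSE OF LEMMA D.**  `z = pb.gen` with `z^dim = 0`, `M` an `R`-module finitely generated
and projective OVER `A`.  If `c ∈ R` acts on `M` as the Casimir map `v ↦ Σ_{j<dim} z^j • Θ(z^{dim−1−j} • v)`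
of some `A`-linear `Θ : M → M`, then `c` STABLY ANNIHILATES `M`: the action factors as
`M —ι→ R ⊗_A M —π→ M`, `ι(v) = Σ_j z^j ⊗ Θ(z^{dim−1−j} v)` (`R`-linear by `casimir_commute`),
`π(x ⊗ m) = x • m`, and `R ⊗_A M` is finitely generated projective over `R`.
[folklore; Higman's criterion / U12-SPEC §6 Lemma D] -/
theorem stablyAnnihilates_of_smul_eq_casimir [Module.Finite A M] [Module.Projective A M]
    (hnil : pb.gen ^ pb.dim = 0) (hd : 0 < pb.dim) (Θ : M →ₗ[A] M) (c : R)
    (hc : ∀ v : M, c • v =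
      ∑ j ∈ Finset.range pb.dim, (pb.gen ^ j) • Θ ((pb.gen ^ (pb.dim - 1 - j)) • v)) :
    StablyAnnihilates R c (ModuleCat.of R M) := by
  -- the Casimir map `ι₀ : M → R ⊗_A M`, `A`-linear
  let N : M →ₗ[A] M := (LinearMap.lsmul R M pb.gen).restrictScalars A
  have hN : ∀ (n : ℕ) (v : M), (N ^ n) v = (pb.gen ^ n) • v := by
    intro n
    induction n with
    | zero => intro v; simp
    | succ n ih =>
      intro v
      rw [pow_succ', Module.End.mul_apply, ih, pow_succ', mul_smul]
      rfl
  let ι₀ : M →ₗ[A] R ⊗[A] M :=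
    ∑ j ∈ Finset.range pb.dim, (TensorProduct.mk A R M (pb.gen ^ j)) ∘ₗ Θ ∘ₗ (N ^ (pb.dim - 1 - j))
  have hι₀ : ∀ v, ι₀ v =
      ∑ j ∈ Finset.range pb.dim, (pb.gen ^ j) ⊗ₜ[A] Θ ((pb.gen ^ (pb.dim - 1 - j)) • v) := by
    intro v
    simp only [ι₀, LinearMap.sum_apply, LinearMap.coe_comp, Function.comp_apply,
      TensorProduct.mk_apply, hN]
  -- `ι₀` commutes with `z`, hence is `R`-linear
  have hcomm : ∀ v, ι₀ (pb.gen • v) = pb.gen • ι₀ v := fun v => by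
    rw [hι₀, hι₀, casimir_commute pb hnil hd Θ v]
  let ι : M →ₗ[R] R ⊗[A] M :=
    { toFun := ι₀
      map_add' := fun v w => ι₀.map_add v w
      map_smul' := fun x v => map_smul_of_commute_gen pb ι₀ hcomm x v }
  -- `π : R ⊗_A M → M`, `x ⊗ m ↦ x • m`
  let π : R ⊗[A] M →ₗ[R] M := (LinearMap.id : M →ₗ[A] M).liftBaseChange R
  refine ⟨ModuleCat.of R (R ⊗[A] M), inferInstance,
    (IsProjective.iff_projective (R := R) (R ⊗[A] M)).mp inferInstance,
    ModuleCat.ofHom ι, ModuleCat.ofHom π, ?_⟩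
  ext v
  have h1 : π (ι v) = c • v := by
    change π (ι₀ v) = c • v
    rw [hι₀, map_sum, hc v]
    refine Finset.sum_congr rfl fun j _ => ?_
    rw [LinearMap.liftBaseChange_tmul, LinearMap.id_apply]
  simpa [ModuleCat.hom_comp, ModuleCat.hom_ofHom] using h1

end Casimir

/-! ## The idempotent certificate (res-L1-w44b-tri-1, `kept/KeptIdempotent.lean` 6f6ae019e1770cdf) -/

/-- Pure ring identity (tri-1): in any semiring, `Θ * N = 0` and `N^r * Θ = N^r` give
`Σ_{j ≤ r} N^j * Θ * N^(r-j) = N^r` (the terms `j < r` contain `Θ * N`). [folklore; inlined from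
res-L1-w44b-tri-1's kernel helper `TriOneKept.sum_pow_mul_mul_pow_eq_pow`] -/
theorem sum_pow_mul_mul_pow_eq_pow {B : Type*} [Semiring B] (N Θ : B) (r : ℕ)
    (hΘN : Θ * N = 0) (hNΘ : N ^ r * Θ = N ^ r) :
    (∑ j ∈ Finset.range (r + 1), N ^ j * Θ * N ^ (r - j)) = N ^ r := by
  rw [Finset.sum_range_succ]
  have hvan : ∀ j ∈ Finset.range r, N ^ j * Θ * N ^ (r - j) = 0 := by
    intro j hj
    have hlt : j < r := Finset.mem_range.mp hj
    obtain ⟨m, hm⟩ : ∃ m, r - j = m + 1 := ⟨r - j - 1, by omega⟩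
    rw [hm, pow_succ', ← mul_assoc, mul_assoc (N ^ j) Θ N, hΘN, mul_zero, zero_mul]
  rw [Finset.sum_eq_zero hvan, zero_add, Nat.sub_self, pow_zero, mul_one, hNΘ]

/-- Existence of the idempotent certificate (tri-1): if `N^(r+1) = 0` and `ker N^r` has a complement
`C`, then `Θ :=` the projection onto `C` along `ker N^r` satisfies `Θ * N = 0` (`range N ≤ ker N^r`)
and `N^r * Θ = N^r`. [folklore; inlined from res-L1-w44b-tri-1's `TriOneKept.exists_theta_of_isCompl`] -/
theorem exists_theta_of_isCompl {S M : Type*} [CommRing S] [AddCommGroup M] [Module S M]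
    (N : Module.End S M) (r : ℕ) (hN : N ^ (r + 1) = 0)
    (C : Submodule S M) (hC : IsCompl C (LinearMap.ker (N ^ r))) :
    ∃ Θ : Module.End S M, Θ * N = 0 ∧ N ^ r * Θ = N ^ r := by
  refine ⟨C.projection (LinearMap.ker (N ^ r)) hC, ?_, ?_⟩
  · apply LinearMap.ext
    intro v
    have hv : N v ∈ LinearMap.ker (N ^ r) := by
      rw [LinearMap.mem_ker]
      have h1 : (N ^ r * N) v = 0 := by rw [← pow_succ, hN, LinearMap.zero_apply]
      simpa [Module.End.mul_apply] using h1
    simp only [Module.End.mul_apply, LinearMap.zero_apply]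
    exact Submodule.projection_apply_of_mem_right hC hv
  · apply LinearMap.ext
    intro v
    have hmem := Submodule.sub_projection_mem hC v
    rw [LinearMap.mem_ker, map_sub, sub_eq_zero] at hmem
    simp only [Module.End.mul_apply]
    exact hmem.symm

/-! ## R4's KEPT half in every characteristic: `z^{r}` stably annihilates every split lattice -/

section Kept

variable (pb : PowerBasis A R) {M : Type u} [AddCommGroup M] [Module R M] [Module A M]
  [IsScalarTower A R M]

/-- **`z^{dim−1}` STABLY ANNIHILATES every split lattice.**  `z = pb.gen` with `z^dim = 0`, `M` an
`R`-module finitely generated projective over `A` such that the kernel of `z^{dim−1}` (as an `A`-linear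
endomorphism) has an `A`-complement.  Then `z^{dim−1}` stably annihilates `M` — via the idempotent
certificate `Θ` (projection along `ker z^{dim−1}`): `Σ_j z^j Θ z^{dim−1−j} = z^{dim−1}` is a Casimir
map.  No derivative and no factor `dim` occur, so this covers the characteristics dividing `dim`
(where `∂_z z^{dim} = 0`).  [OURS; res-L1-w44b-tri-1 REFEREE-LemmaD correction to U12-SPEC §6 Cor. 2] -/
theorem stablyAnnihilates_gen_pow_of_isCompl [Module.Finite A M] [Module.Projective A M]
    (hnil : pb.gen ^ pb.dim = 0) (hd : 0 < pb.dim) (C : Submodule A M)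
    (hC : IsCompl C (LinearMap.ker
      (((LinearMap.lsmul R M pb.gen).restrictScalars A) ^ (pb.dim - 1)))) :
    StablyAnnihilates R (pb.gen ^ (pb.dim - 1)) (ModuleCat.of R M) := by
  set N : Module.End A M := (LinearMap.lsmul R M pb.gen).restrictScalars A with hNdef
  have hN : ∀ (n : ℕ) (v : M), (N ^ n) v = (pb.gen ^ n) • v := by
    intro n
    induction n with
    | zero => intro v; simp
    | succ n ih =>
      intro v
      rw [pow_succ', Module.End.mul_apply, ih, pow_succ', mul_smul]
      rfl
  have hNnil : N ^ (pb.dim - 1 + 1) = 0 := by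
    apply LinearMap.ext
    intro v
    rw [hN, Nat.sub_add_cancel hd, hnil, zero_smul, LinearMap.zero_apply]
  obtain ⟨Θ, hΘN, hNΘ⟩ := exists_theta_of_isCompl N (pb.dim - 1) hNnil C hC
  have hsum := sum_pow_mul_mul_pow_eq_pow N Θ (pb.dim - 1) hΘN hNΘ
  refine stablyAnnihilates_of_smul_eq_casimir pb hnil hd Θ (pb.gen ^ (pb.dim - 1)) fun v => ?_
  have h1 := LinearMap.congr_fun hsum v
  rw [Nat.sub_add_cancel hd, LinearMap.sum_apply] at h1
  rw [← hN, ← h1]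
  refine Finset.sum_congr rfl fun j _ => ?_
  rw [Module.End.mul_apply, Module.End.mul_apply, hN, hN]

/-- Over a FIELD `A = K` every subspace has a complement: `z^{dim−1}` stably annihilates EVERY
`R`-module that is finite-dimensional over `K` (`R ≅ K[z]/(z^{dim})`, any characteristic).
[OURS; tri-1 `TriOneKept.exists_theta_sum_eq_pow`] -/
theorem stablyAnnihilates_gen_pow_of_field {K : Type v} [Field K] {R : Type u} [CommRing R]
    [Algebra K R] (pb : PowerBasis K R) {M : Type u} [AddCommGroup M] [Module R M] [Module K M]
    [IsScalarTower K R M] [Module.Finite K M] (hnil : pb.gen ^ pb.dim = 0) (hd : 0 < pb.dim) :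
    StablyAnnihilates R (pb.gen ^ (pb.dim - 1)) (ModuleCat.of R M) := by
  obtain ⟨C, hC⟩ := Submodule.exists_isCompl
    (LinearMap.ker (((LinearMap.lsmul R M pb.gen).restrictScalars K) ^ (pb.dim - 1)))
  exact stablyAnnihilates_gen_pow_of_isCompl pb hnil hd C hC.symm

end Kept

/-- **Kernels of endomorphisms of finite free modules over a PID are complemented**: for `A` a
principal ideal domain, `M` finitely generated free over `A` and `f : M → M` `A`-linear, `ker f` has
a complement (`M ⧸ ker f ≅ range f` is finitely generated torsion-free, hence free, hence projective,
so `M ↠ range f` splits) — the «saturated ⇒ split over a PID» step of res-L1-w44b-tri-1's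
REFEREE-LemmaD, left open in its kernel helper. [folklore] -/
theorem exists_isCompl_ker_of_pid [IsDomain A] [IsPrincipalIdealRing A] {M : Type*}
    [AddCommGroup M] [Module A M] [Module.Finite A M] [Module.Free A M] (f : M →ₗ[A] M) :
    ∃ C : Submodule A M, IsCompl C (LinearMap.ker f) := by
  obtain ⟨s, hs⟩ := Module.projective_lifting_property f.rangeRestrict
    (LinearMap.id : LinearMap.range f →ₗ[A] LinearMap.range f) f.surjective_rangeRestrict
  have hsinj : Function.Injective s := LinearMap.injective_of_comp_eq_id s f.rangeRestrict hs
  refine ⟨LinearMap.range s, ?_⟩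
  have key : IsCompl (LinearMap.range s)
      (LinearMap.ker (s.rangeRestrict ∘ₗ f.rangeRestrict)) := by
    refine LinearMap.isCompl_of_proj fun x => ?_
    obtain ⟨y, hy⟩ := LinearMap.mem_range.mp x.2
    apply Subtype.ext
    rw [LinearMap.comp_apply, LinearMap.codRestrict_apply, ← hy]
    have h1 : f.rangeRestrict (s y) = y := by
      rw [← LinearMap.comp_apply, hs, LinearMap.id_apply]
    change s (f.rangeRestrict (s y)) = s y
    rw [h1]
  have hker : LinearMap.ker (s.rangeRestrict ∘ₗ f.rangeRestrict) = LinearMap.ker f := by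
    rw [LinearMap.ker_comp, LinearMap.ker_rangeRestrict, (LinearMap.ker_eq_bot.mpr hsinj),
      Submodule.comap_bot, LinearMap.ker_rangeRestrict]
  rwa [hker] at key

/-- **`z^{dim−1}` stably annihilates every lattice over a PID** (`A` a principal ideal domain — e.g.
`K[t]`, `K⟦t⟧` —, `M` finitely generated free over `A`): R4's KEPT half at lattice level in EVERY
characteristic, hypothesis-free. [OURS; tri-1 REFEREE-LemmaD correction, fully formalised] -/
theorem stablyAnnihilates_gen_pow_of_pid [IsDomain A] [IsPrincipalIdealRing A] (pb : PowerBasis A R)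
    {M : Type u} [AddCommGroup M] [Module R M] [Module A M] [IsScalarTower A R M]
    [Module.Finite A M] [Module.Free A M] (hnil : pb.gen ^ pb.dim = 0) (hd : 0 < pb.dim) :
    StablyAnnihilates R (pb.gen ^ (pb.dim - 1)) (ModuleCat.of R M) := by
  obtain ⟨C, hC⟩ := exists_isCompl_ker_of_pid
    (((LinearMap.lsmul R M pb.gen).restrictScalars A) ^ (pb.dim - 1))
  exact stablyAnnihilates_gen_pow_of_isCompl pb hnil hd C hC

end Summit.ResolutionOfSingularities.ResolutionOfSingularities.Theorems.HomologicalConductor.PersistenceLatticeCasimir
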